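import Summits.AtomisticToContinuum.HydrodynamicLimit.Theses.OneSphereInfluence

/-!
# Birth skeleton — crux `OneSphereInfluence.ScoreLinearResponse` (stmt-AtomisticToContinuum-13617)

Skeleton registrar (planner one-shot, route re-audit bin REPAIRABLE, 2026-08-17), route
`route-AtomisticToContinuum-OneSphereInfluence`, sub-problem `HydrodynamicLimit`.

The crux asks for the score linear response `Cov_{p_κ^N}(S_κ, ⟨U_N(t),χ⟩) → ∂_κ⟨U_κ(t),χ⟩`
UNIFORMLY in the homotopy parameter `κ ∈ [0,1]` (density, momentum components, energy).
Decomposition (Arzelà–Ascoli seam: on the compact parameter interval, uniform convergence =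
pointwise convergence + equicontinuity of the prelimit family):

* `stub_pointwiseScoreResponse` — LOCAL-EQUILIBRIUM LINEAR RESPONSE AT EACH STATE OF THE PATH:
  under exactly the hypotheses of the crux, for every fixed `κ ∈ [0,1]` the finite-`N` score
  covariance converges to the `κ`-derivative of the Euler field (the physics: Euler-scale
  response of the hard-sphere gas prepared in the local Gibbs state `p_κ`; `κ = 0` is the
  global-equilibrium case `EquilibriumLinearResponse`, Spohn 1991 (7.19) in response form).
  Size: open-problem (the dynamical content of the crux), but WITHOUT any uniformity in `κ`.
* `stub_scoreResponseEquicontinuity` — `N`-UNIFORM MODULUS OF CONTINUITY OF THE FINITE-`N`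
  RESPONSE IN THE PATH PARAMETER: for every smooth profile path with activities in the `Λ`-hull
  (no Euler solution, no LLN matching, no endpoint conditions, every `t ≥ 0`), the family
  `κ ↦ Cov_{p_κ^N}(S_κ^N, ⟨U_N(t),χ⟩)`, `N ∈ ℕ`, is equicontinuous on `[0,1]`. Since
  `Cov_{p_κ}(S_κ,F_t) = ∂_κ E_{p_κ} F_t` (score identity), this is an `N`-uniform bound on the
  SECOND-order response `∂²_κ E_{p_κ}F_t`, i.e. on the joint third cumulant `κ₃(S_κ,S_κ,F_t)` plus
  `Cov(∂_κ S_κ, F_t)` — a dynamic cumulant bound of CLT type (static at `t = 0`: cluster expansion).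
  Size: L.
* `scoreLinearResponse_of_parts : stub₁-sig → stub₂-sig → ‹crux signature›` — the composition,
  sorry-free: `σ₀ := min σ₁ σ₂`, then on the compact `Icc 0 1` pointwise convergence of an
  equicontinuous family is uniform (`Equicontinuous.tendsto_uniformFun_iff_pi`, restricted to the
  subtype `Icc 0 1`); `ScoreLinearResponse_of : ScoreLinearResponse` (BY NAME) applies it to the two
  declared stubs — the shape the registered audit `#h21_check_skeleton` accepts (sorries only inside
  `stub_*`, no other hypothesis).

Neither stub is the crux or the summit in costume: pointwise convergence on `[0,1]` does not give
`TendstoUniformlyOn` without a compactness input, and equicontinuity identifies no limit at all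
(BC3 probes, farm-checked 2026-08-17: for each stub, `stub → ScoreLinearResponse` and
`stub → _root_.HydrodynamicLimit` by each of `exact?`, `simpa`, `simpa [·]`, `unfold ·; simpa`,
`aesop` at 400000 heartbeats — 4 files × 5 probes, all FAIL: `exact?` "could not close the goal",
`simpa` "assumption failed" / whnf timeout, `aesop` timeout; registrar NOTES.md `birth-certificate:`).
Disproof used: none on file for this crux (`ledger crux ls`: no Disproof.lean at registration).
-/

namespace Summit.AtomisticToContinuum.HydrodynamicLimit.Cruxes.ScoreLinearResponse.Birth

open scoped BigOperators Topology Manifold Classical MeasureTheory ProbabilityTheory Matrix InnerProductSpace ComplexConjugate ContinuousMap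
open Filter Set Function TopologicalSpace MeasureTheory

/-- STUB 1 (open-problem; the physics at FIXED `κ`): local-equilibrium score linear response,
pointwise in the path parameter `κ ∈ [0,1]`, under exactly the hypotheses of the crux.
`κ = 0` is `EquilibriumLinearResponse` (Spohn1991 §7.1 (7.19) in response form); `t = 0` is the
static response (cluster expansion). Sources: Spohn1991, Duerinckx2021 (arXiv:1912.01366),
EvansMorriss2008, Resibois1978. -/
theorem stub_pointwiseScoreResponse : ∀ (a₁ θ₁ : Literature.MathematicalPhysics.KineticTheory.T3 → ℝ) (u₁ : Literature.MathematicalPhysics.KineticTheory.T3 → Literature.MathematicalPhysics.KineticTheory.V3), Continuous a₁ → Continuous θ₁ → Continuous u₁ → (∀ x, 0 < a₁ x) → (∀ x, 0 < θ₁ x) → ∀ Λ : ℝ, 1 ≤ Λ → ∃ σ₀ : ℝ, 0 < σ₀ ∧ ∀ σ : ℝ, 0 < σ → σ < σ₀ → ∀ (a θ₀ : ℝ → Literature.MathematicalPhysics.KineticTheory.T3 → ℝ) (u₀ : ℝ → Literature.MathematicalPhysics.KineticTheory.T3 → Literature.MathematicalPhysics.KineticTheory.V3), Literature.Analysis.FunctionSpaces.Torus.IsSmoothSpaceTimeOn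 (Set.Icc 0 1) a → Literature.Analysis.FunctionSpaces.Torus.IsSmoothSpaceTimeOn (Set.Icc 0 1) θ₀ → Literature.Analysis.FunctionSpaces.Torus.IsSmoothSpaceTimeOn (Set.Icc 0 1) u₀ → (∀ κ ∈ Set.Icc (0 : ℝ) 1, ∀ x, Λ⁻¹ * (⨅ y, a₁ y) ≤ a κ x ∧ a κ x ≤ Λ * (⨆ y, a₁ y) ∧ 0 < θ₀ κ x) → (∀ x, a 0 x = a 0 0 ∧ θ₀ 0 x = θ₀ 0 0 ∧ u₀ 0 x = u₀ 0 0) → a 1 = a₁ → θ₀ 1 = θ₁ → u₀ 1 = u₁ → ∀ (T : ℝ) (ρ θ : ℝ → ℝ → Literature.MathematicalPhysics.KineticTheory.T3 → ℝ) (u : ℝ → ℝ → Literature.MathematicalPhysics.KineticTheory.T3 → Literature.MathematicalPhysics.KineticTheory.V3), (∀ κ ∈ Set.Icc (0 : ℝ) 1, Literature.MathematicalPhysics.KineticTheory.IsHardSphereEulerSolution σ T (ρ κ) (u κ) (θ κ)) → ContDiffOn ℝ ((⊤ : ℕ∞) : WithTop ℕ∞) (fun q : ℝ × ℝ × EuclideanSpace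 ℝ (Fin 3) => ρ q.1 q.2.1 (Literature.Analysis.FunctionSpaces.Torus.proj q.2.2)) (Set.Icc 0 1 ×ˢ (Set.Ico 0 T ×ˢ Set.univ)) → ContDiffOn ℝ ((⊤ : ℕ∞) : WithTop ℕ∞) (fun q : ℝ × ℝ × EuclideanSpace ℝ (Fin 3) => u q.1 q.2.1 (Literature.Analysis.FunctionSpaces.Torus.proj q.2.2)) (Set.Icc 0 1 ×ˢ (Set.Ico 0 T ×ˢ Set.univ)) → ContDiffOn ℝ ((⊤ : ℕ∞) : WithTop ℕ∞) (fun q : ℝ × ℝ × EuclideanSpace ℝ (Fin 3) => θ q.1 q.2.1 (Literature.Analysis.FunctionSpaces.Torus.proj q.2.2)) (Set.Icc 0 1 ×ˢ (Set.Ico 0 T ×ˢ Set.univ)) → ∀ Φ : (N : ℕ) → Literature.Analysis.FluidPDE.HardSphereFlow (Literature.Analysis.FluidPDE.Torus.geometry (Fin 3)) (Literature.MathematicalPhysics.KineticTheory.hsDiameter σ N) (N + 1), (∀ κ ∈ Set.Icc (0 : ℝ) 1, Literature.MathematicalPhysics.KineticTheory.TendstoHydroFieldsAt (fun N => Literature.MathematicalPhysics.KineticTheory.localGibbsLaw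 σ (a κ) (u₀ κ) (θ₀ κ) N (Φ N)) Φ (ρ κ) (u κ) (θ κ) 0) → ∀ t ∈ Set.Ico 0 T, ∀ χ : Literature.MathematicalPhysics.KineticTheory.T3 → ℝ, Continuous χ → let p : ℝ → (N : ℕ) → MeasureTheory.Measure (Literature.Analysis.FluidPDE.Config (N + 1) (Fin 3) Literature.MathematicalPhysics.KineticTheory.T3) := fun κ N => Literature.MathematicalPhysics.KineticTheory.localGibbsLaw σ (a κ) (u₀ κ) (θ₀ κ) N (Φ N); let S : ℝ → (N : ℕ) → Literature.Analysis.FluidPDE.Config (N + 1) (Fin 3) Literature.MathematicalPhysics.KineticTheory.T3 → ℝ := fun κ N z => ∑ i, derivWithin (fun κ' => Real.log (Literature.MathematicalPhysics.KineticTheory.localGibbsProfile (a κ') (u₀ κ') (θ₀ κ') (z i))) (Set.Icc 0 1) κ; (∀ κ ∈ Set.Icc (0 : ℝ) 1, Filter.Tendsto (fun N : ℕ => ProbabilityTheory.covariance (S κ N) (fun z => Literature.MathematicalPhysics.KineticTheory.empiricalDensityField ((Φ N).flow t z) χ) (p κ N)) Filter.atTop (nhds (derivWithin (fun κ' => ∫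 x, χ x * ρ κ' t x) (Set.Icc 0 1) κ))) ∧ (∀ j : Fin 3, ∀ κ ∈ Set.Icc (0 : ℝ) 1, Filter.Tendsto (fun N : ℕ => ProbabilityTheory.covariance (S κ N) (fun z => Literature.MathematicalPhysics.KineticTheory.empiricalMomentumField ((Φ N).flow t z) χ j) (p κ N)) Filter.atTop (nhds (derivWithin (fun κ' => ∫ x, χ x * ρ κ' t x * u κ' t x j) (Set.Icc 0 1) κ))) ∧ (∀ κ ∈ Set.Icc (0 : ℝ) 1, Filter.Tendsto (fun N : ℕ => ProbabilityTheory.covariance (S κ N) (fun z => Literature.MathematicalPhysics.KineticTheory.empiricalEnergyField ((Φ N).flow t z) χ) (p κ N)) Filter.atTop (nhds (derivWithin (fun κ' => ∫ x, χ x * Literature.MathematicalPhysics.KineticTheory.totalEnergyDensity (ρ κ' t x) (u κ' t x) (θ κ' t x)) (Set.Icc 0 1) κ))) := by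
  sorry

/-- STUB 2 (size L; `N`-uniform regularity of the finite-`N` response in the initial-law
parameter): for every smooth profile path with activities in the `Λ`-hull of `a₁` and every
`t ≥ 0`, the family of finite-`N` score covariances `κ ↦ Cov_{p_κ^N}(S_κ^N, ⟨U_N(t),χ⟩)`,
`N ∈ ℕ`, is equicontinuous on `[0,1]` (an `N`-uniform bound on the second-order response
`∂²_κ E_{p_κ} F_t`, a joint third-cumulant bound; no Euler solution enters).
Sources: Spohn1991 Part II §7, LastPenrose2017 Thm 19.1 (score / Margulis–Russo identities),
Bertini2002 Thm 2.2, HelmuthPerkinsPetti2022 (static cumulant control at small packing). -/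
theorem stub_scoreResponseEquicontinuity : ∀ (a₁ θ₁ : Literature.MathematicalPhysics.KineticTheory.T3 → ℝ) (u₁ : Literature.MathematicalPhysics.KineticTheory.T3 → Literature.MathematicalPhysics.KineticTheory.V3), Continuous a₁ → Continuous θ₁ → Continuous u₁ → (∀ x, 0 < a₁ x) → (∀ x, 0 < θ₁ x) → ∀ Λ : ℝ, 1 ≤ Λ → ∃ σ₀ : ℝ, 0 < σ₀ ∧ ∀ σ : ℝ, 0 < σ → σ < σ₀ → ∀ (a θ₀ : ℝ → Literature.MathematicalPhysics.KineticTheory.T3 → ℝ) (u₀ : ℝ → Literature.MathematicalPhysics.KineticTheory.T3 → Literature.MathematicalPhysics.KineticTheory.V3), Literature.Analysis.FunctionSpaces.Torus.IsSmoothSpaceTimeOn (Set.Icc 0 1) a → Literature.Analysis.FunctionSpaces.Torus.IsSmoothSpaceTimeOn (Set.Icc 0 1) θ₀ → Literature.Analysis.FunctionSpaces.Torus.IsSmoothSpaceTimeOn (Set.Icc 0 1) u₀ → (∀ κ ∈ Set.Icc (0 : ℝ) 1, ∀ x, Λ⁻¹ * (⨅ y, a₁ y) ≤ a κ x ∧ a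 κ x ≤ Λ * (⨆ y, a₁ y) ∧ 0 < θ₀ κ x) → ∀ Φ : (N : ℕ) → Literature.Analysis.FluidPDE.HardSphereFlow (Literature.Analysis.FluidPDE.Torus.geometry (Fin 3)) (Literature.MathematicalPhysics.KineticTheory.hsDiameter σ N) (N + 1), ∀ t : ℝ, 0 ≤ t → ∀ χ : Literature.MathematicalPhysics.KineticTheory.T3 → ℝ, Continuous χ → let p : ℝ → (N : ℕ) → MeasureTheory.Measure (Literature.Analysis.FluidPDE.Config (N + 1) (Fin 3) Literature.MathematicalPhysics.KineticTheory.T3) := fun κ N => Literature.MathematicalPhysics.KineticTheory.localGibbsLaw σ (a κ) (u₀ κ) (θ₀ κ) N (Φ N); let S : ℝ → (N : ℕ) → Literature.Analysis.FluidPDE.Config (N + 1) (Fin 3) Literature.MathematicalPhysics.KineticTheory.T3 → ℝ := fun κ N z => ∑ i, derivWithin (fun κ' => Real.log (Literature.MathematicalPhysics.KineticTheory.localGibbsProfile (a κ') (u₀ κ') (θ₀ κ') (z i))) (Set.Icc 0 1) κ; EquicontinuousOn (fun (N : ℕ) (κ : ℝ) => ProbabilityTheory.covariance (S κ N) (fun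 z => Literature.MathematicalPhysics.KineticTheory.empiricalDensityField ((Φ N).flow t z) χ) (p κ N)) (Set.Icc (0 : ℝ) 1) ∧ (∀ j : Fin 3, EquicontinuousOn (fun (N : ℕ) (κ : ℝ) => ProbabilityTheory.covariance (S κ N) (fun z => Literature.MathematicalPhysics.KineticTheory.empiricalMomentumField ((Φ N).flow t z) χ j) (p κ N)) (Set.Icc (0 : ℝ) 1)) ∧ EquicontinuousOn (fun (N : ℕ) (κ : ℝ) => ProbabilityTheory.covariance (S κ N) (fun z => Literature.MathematicalPhysics.KineticTheory.empiricalEnergyField ((Φ N).flow t z) χ) (p κ N)) (Set.Icc (0 : ℝ) 1) := by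
  sorry

/-- Arzelà–Ascoli seam (proved): on a compact set, an equicontinuous family that converges
pointwise converges uniformly (`Equicontinuous.tendsto_uniformFun_iff_pi` on the subtype). -/
theorem tendstoUniformlyOn_of_equicontinuousOn {ι X α : Type*} [TopologicalSpace X]
    [UniformSpace α] {F : ι → X → α} {f : X → α} {K : Set X} {l : Filter ι}
    (hK : IsCompact K) (hF : EquicontinuousOn F K)
    (h : ∀ x ∈ K, Tendsto (fun i => F i x) l (𝓝 (f x))) : TendstoUniformlyOn F f l K := by
  rw [tendstoUniformlyOn_iff_restrict]
  haveI : CompactSpace K := isCompact_iff_compactSpace.mp hK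
  have hF' : Equicontinuous (K.restrict ∘ F) := (equicontinuous_restrict_iff F).mpr hF
  have hpt : Tendsto (K.restrict ∘ F) l (𝓝 (K.restrict f)) :=
    tendsto_pi_nhds.mpr fun x => h x x.2
  have key := (hF'.tendsto_uniformFun_iff_pi l (K.restrict f)).mpr hpt
  exact UniformFun.tendsto_iff_tendstoUniformly.mp key

set_option linter.unusedVariables false in
/-- The composition in HYPOTHESES form (sorry-free; axioms `propext`, `Classical.choice`, `Quot.sound`):
`stub₁-signature → stub₂-signature → ‹the crux signature, spelled verbatim›` — `σ₀ := min σ₁ σ₂`, then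
pointwise convergence + equicontinuity on the compact `Icc 0 1` ⇒ uniform convergence, field by field.
(The conclusion is the crux decl UNFOLDED on purpose: the registered skeleton audit `#h21_check_skeleton`
takes as THE skeleton the unique theorem concluding the crux BY NAME with no hypotheses — that is
`ScoreLinearResponse_of` below, which applies this one to the two declared stubs.) -/
theorem scoreLinearResponse_of_parts : (∀ (a₁ θ₁ : Literature.MathematicalPhysics.KineticTheory.T3 → ℝ) (u₁ : Literature.MathematicalPhysics.KineticTheory.T3 → Literature.MathematicalPhysics.KineticTheory.V3), Continuous a₁ → Continuous θ₁ → Continuous u₁ → (∀ x, 0 < a₁ x) → (∀ x, 0 < θ₁ x) → ∀ Λ : ℝ, 1 ≤ Λ → ∃ σ₀ : ℝ, 0 < σ₀ ∧ ∀ σ : ℝ, 0 < σ → σ < σ₀ → ∀ (a θ₀ : ℝ → Literature.MathematicalPhysics.KineticTheory.T3 → ℝ) (u₀ : ℝ → Literature.MathematicalPhysics.KineticTheory.T3 → Literature.MathematicalPhysics.KineticTheory.V3), Literature.Analysis.FunctionSpaces.Torus.IsSmoothSpaceTimeOn (Set.Icc 0 1) a → Literature.Analysis.FunctionSpaces.Torus.IsSmoothSpaceTimeOn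 (Set.Icc 0 1) θ₀ → Literature.Analysis.FunctionSpaces.Torus.IsSmoothSpaceTimeOn (Set.Icc 0 1) u₀ → (∀ κ ∈ Set.Icc (0 : ℝ) 1, ∀ x, Λ⁻¹ * (⨅ y, a₁ y) ≤ a κ x ∧ a κ x ≤ Λ * (⨆ y, a₁ y) ∧ 0 < θ₀ κ x) → (∀ x, a 0 x = a 0 0 ∧ θ₀ 0 x = θ₀ 0 0 ∧ u₀ 0 x = u₀ 0 0) → a 1 = a₁ → θ₀ 1 = θ₁ → u₀ 1 = u₁ → ∀ (T : ℝ) (ρ θ : ℝ → ℝ → Literature.MathematicalPhysics.KineticTheory.T3 → ℝ) (u : ℝ → ℝ → Literature.MathematicalPhysics.KineticTheory.T3 → Literature.MathematicalPhysics.KineticTheory.V3), (∀ κ ∈ Set.Icc (0 : ℝ) 1, Literature.MathematicalPhysics.KineticTheory.IsHardSphereEulerSolution σ T (ρ κ) (u κ) (θ κ)) → ContDiffOn ℝ ((⊤ : ℕ∞) : WithTop ℕ∞) (fun q : ℝ × ℝ × EuclideanSpace ℝ (Fin 3) => ρ q.1 q.2.1 (Literature.Analysis.FunctionSpaces.Torus.proj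 q.2.2)) (Set.Icc 0 1 ×ˢ (Set.Ico 0 T ×ˢ Set.univ)) → ContDiffOn ℝ ((⊤ : ℕ∞) : WithTop ℕ∞) (fun q : ℝ × ℝ × EuclideanSpace ℝ (Fin 3) => u q.1 q.2.1 (Literature.Analysis.FunctionSpaces.Torus.proj q.2.2)) (Set.Icc 0 1 ×ˢ (Set.Ico 0 T ×ˢ Set.univ)) → ContDiffOn ℝ ((⊤ : ℕ∞) : WithTop ℕ∞) (fun q : ℝ × ℝ × EuclideanSpace ℝ (Fin 3) => θ q.1 q.2.1 (Literature.Analysis.FunctionSpaces.Torus.proj q.2.2)) (Set.Icc 0 1 ×ˢ (Set.Ico 0 T ×ˢ Set.univ)) → ∀ Φ : (N : ℕ) → Literature.Analysis.FluidPDE.HardSphereFlow (Literature.Analysis.FluidPDE.Torus.geometry (Fin 3)) (Literature.MathematicalPhysics.KineticTheory.hsDiameter σ N) (N + 1), (∀ κ ∈ Set.Icc (0 : ℝ) 1, Literature.MathematicalPhysics.KineticTheory.TendstoHydroFieldsAt (fun N => Literature.MathematicalPhysics.KineticTheory.localGibbsLaw σ (a κ) (u₀ κ) (θ₀ κ) N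 (Φ N)) Φ (ρ κ) (u κ) (θ κ) 0) → ∀ t ∈ Set.Ico 0 T, ∀ χ : Literature.MathematicalPhysics.KineticTheory.T3 → ℝ, Continuous χ → let p : ℝ → (N : ℕ) → MeasureTheory.Measure (Literature.Analysis.FluidPDE.Config (N + 1) (Fin 3) Literature.MathematicalPhysics.KineticTheory.T3) := fun κ N => Literature.MathematicalPhysics.KineticTheory.localGibbsLaw σ (a κ) (u₀ κ) (θ₀ κ) N (Φ N); let S : ℝ → (N : ℕ) → Literature.Analysis.FluidPDE.Config (N + 1) (Fin 3) Literature.MathematicalPhysics.KineticTheory.T3 → ℝ := fun κ N z => ∑ i, derivWithin (fun κ' => Real.log (Literature.MathematicalPhysics.KineticTheory.localGibbsProfile (a κ') (u₀ κ') (θ₀ κ') (z i))) (Set.Icc 0 1) κ; (∀ κ ∈ Set.Icc (0 : ℝ) 1, Filter.Tendsto (fun N : ℕ => ProbabilityTheory.covariance (S κ N) (fun z => Literature.MathematicalPhysics.KineticTheory.empiricalDensityField ((Φ N).flow t z) χ) (p κ N)) Filter.atTop (nhds (derivWithin (fun κ' => ∫ x, χ x * ρ κ' t x) (Set.Icc 0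 1) κ))) ∧ (∀ j : Fin 3, ∀ κ ∈ Set.Icc (0 : ℝ) 1, Filter.Tendsto (fun N : ℕ => ProbabilityTheory.covariance (S κ N) (fun z => Literature.MathematicalPhysics.KineticTheory.empiricalMomentumField ((Φ N).flow t z) χ j) (p κ N)) Filter.atTop (nhds (derivWithin (fun κ' => ∫ x, χ x * ρ κ' t x * u κ' t x j) (Set.Icc 0 1) κ))) ∧ (∀ κ ∈ Set.Icc (0 : ℝ) 1, Filter.Tendsto (fun N : ℕ => ProbabilityTheory.covariance (S κ N) (fun z => Literature.MathematicalPhysics.KineticTheory.empiricalEnergyField ((Φ N).flow t z) χ) (p κ N)) Filter.atTop (nhds (derivWithin (fun κ' => ∫ x, χ x * Literature.MathematicalPhysics.KineticTheory.totalEnergyDensity (ρ κ' t x) (u κ' t x) (θ κ' t x)) (Set.Icc 0 1) κ)))) → (∀ (a₁ θ₁ : Literature.MathematicalPhysics.KineticTheory.T3 → ℝ) (u₁ : Literature.MathematicalPhysics.KineticTheory.T3 → Literature.MathematicalPhysics.KineticTheory.V3), Continuous a₁ → Continuous θ₁ → Continuous u₁ → (∀ x, 0 < a₁ x) → (∀ x,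 0 < θ₁ x) → ∀ Λ : ℝ, 1 ≤ Λ → ∃ σ₀ : ℝ, 0 < σ₀ ∧ ∀ σ : ℝ, 0 < σ → σ < σ₀ → ∀ (a θ₀ : ℝ → Literature.MathematicalPhysics.KineticTheory.T3 → ℝ) (u₀ : ℝ → Literature.MathematicalPhysics.KineticTheory.T3 → Literature.MathematicalPhysics.KineticTheory.V3), Literature.Analysis.FunctionSpaces.Torus.IsSmoothSpaceTimeOn (Set.Icc 0 1) a → Literature.Analysis.FunctionSpaces.Torus.IsSmoothSpaceTimeOn (Set.Icc 0 1) θ₀ → Literature.Analysis.FunctionSpaces.Torus.IsSmoothSpaceTimeOn (Set.Icc 0 1) u₀ → (∀ κ ∈ Set.Icc (0 : ℝ) 1, ∀ x, Λ⁻¹ * (⨅ y, a₁ y) ≤ a κ x ∧ a κ x ≤ Λ * (⨆ y, a₁ y) ∧ 0 < θ₀ κ x) → ∀ Φ : (N : ℕ) → Literature.Analysis.FluidPDE.HardSphereFlow (Literature.Analysis.FluidPDE.Torus.geometry (Fin 3)) (Literature.MathematicalPhysics.KineticTheory.hsDiameter σ N) (N + 1), ∀ t : ℝ, 0 ≤ t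 → ∀ χ : Literature.MathematicalPhysics.KineticTheory.T3 → ℝ, Continuous χ → let p : ℝ → (N : ℕ) → MeasureTheory.Measure (Literature.Analysis.FluidPDE.Config (N + 1) (Fin 3) Literature.MathematicalPhysics.KineticTheory.T3) := fun κ N => Literature.MathematicalPhysics.KineticTheory.localGibbsLaw σ (a κ) (u₀ κ) (θ₀ κ) N (Φ N); let S : ℝ → (N : ℕ) → Literature.Analysis.FluidPDE.Config (N + 1) (Fin 3) Literature.MathematicalPhysics.KineticTheory.T3 → ℝ := fun κ N z => ∑ i, derivWithin (fun κ' => Real.log (Literature.MathematicalPhysics.KineticTheory.localGibbsProfile (a κ') (u₀ κ') (θ₀ κ') (z i))) (Set.Icc 0 1) κ; EquicontinuousOn (fun (N : ℕ) (κ : ℝ) => ProbabilityTheory.covariance (S κ N) (fun z => Literature.MathematicalPhysics.KineticTheory.empiricalDensityField ((Φ N).flow t z) χ) (p κ N)) (Set.Icc (0 : ℝ) 1) ∧ (∀ j : Fin 3, EquicontinuousOn (fun (N : ℕ) (κ : ℝ) => ProbabilityTheory.covariance (S κ N) (fun z => Literature.MathematicalPhysics.KineticTheory.empiricalMomentumField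 ((Φ N).flow t z) χ j) (p κ N)) (Set.Icc (0 : ℝ) 1)) ∧ EquicontinuousOn (fun (N : ℕ) (κ : ℝ) => ProbabilityTheory.covariance (S κ N) (fun z => Literature.MathematicalPhysics.KineticTheory.empiricalEnergyField ((Φ N).flow t z) χ) (p κ N)) (Set.Icc (0 : ℝ) 1)) →
    ∀ (a₁ θ₁ : Literature.MathematicalPhysics.KineticTheory.T3 → ℝ) (u₁ : Literature.MathematicalPhysics.KineticTheory.T3 → Literature.MathematicalPhysics.KineticTheory.V3), Continuous a₁ → Continuous θ₁ → Continuous u₁ → (∀ x, 0 < a₁ x) → (∀ x, 0 < θ₁ x) → ∀ Λ : ℝ, 1 ≤ Λ → ∃ σ₀ : ℝ, 0 < σ₀ ∧ ∀ σ : ℝ, 0 < σ → σ < σ₀ → ∀ (a θ₀ : ℝ → Literature.MathematicalPhysics.KineticTheory.T3 → ℝ) (u₀ : ℝ → Literature.MathematicalPhysics.KineticTheory.T3 → Literature.MathematicalPhysics.KineticTheory.V3), Literature.Analysis.FunctionSpaces.Torus.IsSmoothSpaceTimeOn (Set.Icc 0 1) a → Literature.Analysis.FunctionSpaces.Torus.IsSmoothSpaceTimeOn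 (Set.Icc 0 1) θ₀ → Literature.Analysis.FunctionSpaces.Torus.IsSmoothSpaceTimeOn (Set.Icc 0 1) u₀ → (∀ κ ∈ Set.Icc (0 : ℝ) 1, ∀ x, Λ⁻¹ * (⨅ y, a₁ y) ≤ a κ x ∧ a κ x ≤ Λ * (⨆ y, a₁ y) ∧ 0 < θ₀ κ x) → (∀ x, a 0 x = a 0 0 ∧ θ₀ 0 x = θ₀ 0 0 ∧ u₀ 0 x = u₀ 0 0) → a 1 = a₁ → θ₀ 1 = θ₁ → u₀ 1 = u₁ → ∀ (T : ℝ) (ρ θ : ℝ → ℝ → Literature.MathematicalPhysics.KineticTheory.T3 → ℝ) (u : ℝ → ℝ → Literature.MathematicalPhysics.KineticTheory.T3 → Literature.MathematicalPhysics.KineticTheory.V3), (∀ κ ∈ Set.Icc (0 : ℝ) 1, Literature.MathematicalPhysics.KineticTheory.IsHardSphereEulerSolution σ T (ρ κ) (u κ) (θ κ)) → ContDiffOn ℝ ((⊤ : ℕ∞) : WithTop ℕ∞) (fun q : ℝ × ℝ × EuclideanSpace ℝ (Fin 3) => ρ q.1 q.2.1 (Literature.Analysis.FunctionSpaces.Torus.proj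 q.2.2)) (Set.Icc 0 1 ×ˢ (Set.Ico 0 T ×ˢ Set.univ)) → ContDiffOn ℝ ((⊤ : ℕ∞) : WithTop ℕ∞) (fun q : ℝ × ℝ × EuclideanSpace ℝ (Fin 3) => u q.1 q.2.1 (Literature.Analysis.FunctionSpaces.Torus.proj q.2.2)) (Set.Icc 0 1 ×ˢ (Set.Ico 0 T ×ˢ Set.univ)) → ContDiffOn ℝ ((⊤ : ℕ∞) : WithTop ℕ∞) (fun q : ℝ × ℝ × EuclideanSpace ℝ (Fin 3) => θ q.1 q.2.1 (Literature.Analysis.FunctionSpaces.Torus.proj q.2.2)) (Set.Icc 0 1 ×ˢ (Set.Ico 0 T ×ˢ Set.univ)) → ∀ Φ : (N : ℕ) → Literature.Analysis.FluidPDE.HardSphereFlow (Literature.Analysis.FluidPDE.Torus.geometry (Fin 3)) (Literature.MathematicalPhysics.KineticTheory.hsDiameter σ N) (N + 1), (∀ κ ∈ Set.Icc (0 : ℝ) 1, Literature.MathematicalPhysics.KineticTheory.TendstoHydroFieldsAt (fun N => Literature.MathematicalPhysics.KineticTheory.localGibbsLaw σ (a κ) (u₀ κ) (θ₀ κ) N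 (Φ N)) Φ (ρ κ) (u κ) (θ κ) 0) → ∀ t ∈ Set.Ico 0 T, ∀ χ : Literature.MathematicalPhysics.KineticTheory.T3 → ℝ, Continuous χ → let p : ℝ → (N : ℕ) → MeasureTheory.Measure (Literature.Analysis.FluidPDE.Config (N + 1) (Fin 3) Literature.MathematicalPhysics.KineticTheory.T3) := fun κ N => Literature.MathematicalPhysics.KineticTheory.localGibbsLaw σ (a κ) (u₀ κ) (θ₀ κ) N (Φ N); let S : ℝ → (N : ℕ) → Literature.Analysis.FluidPDE.Config (N + 1) (Fin 3) Literature.MathematicalPhysics.KineticTheory.T3 → ℝ := fun κ N z => ∑ i, derivWithin (fun κ' => Real.log (Literature.MathematicalPhysics.KineticTheory.localGibbsProfile (a κ') (u₀ κ') (θ₀ κ') (z i))) (Set.Icc 0 1) κ; TendstoUniformlyOn (fun N κ => ProbabilityTheory.covariance (S κ N) (fun z => Literature.MathematicalPhysics.KineticTheory.empiricalDensityField ((Φ N).flow t z) χ) (p κ N)) (fun κ => derivWithin (fun κ' => ∫ x, χ x * ρ κ' t x) (Set.Icc 0 1) κ) Filter.atTop (Set.Icc 0 1) ∧ (∀ j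 : Fin 3, TendstoUniformlyOn (fun N κ => ProbabilityTheory.covariance (S κ N) (fun z => Literature.MathematicalPhysics.KineticTheory.empiricalMomentumField ((Φ N).flow t z) χ j) (p κ N)) (fun κ => derivWithin (fun κ' => ∫ x, χ x * ρ κ' t x * u κ' t x j) (Set.Icc 0 1) κ) Filter.atTop (Set.Icc 0 1)) ∧ TendstoUniformlyOn (fun N κ => ProbabilityTheory.covariance (S κ N) (fun z => Literature.MathematicalPhysics.KineticTheory.empiricalEnergyField ((Φ N).flow t z) χ) (p κ N)) (fun κ => derivWithin (fun κ' => ∫ x, χ x * Literature.MathematicalPhysics.KineticTheory.totalEnergyDensity (ρ κ' t x) (u κ' t x) (θ κ' t x)) (Set.Icc 0 1) κ) Filter.atTop (Set.Icc 0 1) := by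
  intro hpt heq a₁ θ₁ u₁ ha₁ hθ₁ hu₁ ha₁pos hθ₁pos Λ hΛ
  obtain ⟨σ₁, hσ₁, h₁⟩ := hpt a₁ θ₁ u₁ ha₁ hθ₁ hu₁ ha₁pos hθ₁pos Λ hΛ
  obtain ⟨σ₂, hσ₂, h₂⟩ := heq a₁ θ₁ u₁ ha₁ hθ₁ hu₁ ha₁pos hθ₁pos Λ hΛ
  refine ⟨min σ₁ σ₂, lt_min hσ₁ hσ₂, ?_⟩
  intro σ hσ hσlt a θ₀ u₀ hsa hsθ hsu hhull hconst ha1 hθ1 hu1 T ρ θ u hE hρs hus hθs Φ hLLN t ht χ hχ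
  have H₁ := h₁ σ hσ (lt_of_lt_of_le hσlt (min_le_left _ _)) a θ₀ u₀ hsa hsθ hsu hhull hconst ha1
    hθ1 hu1 T ρ θ u hE hρs hus hθs Φ hLLN t ht χ hχ
  have H₂ := h₂ σ hσ (lt_of_lt_of_le hσlt (min_le_right _ _)) a θ₀ u₀ hsa hsθ hsu hhull Φ t ht.1 χ hχ
  obtain ⟨H₁d, H₁m, H₁e⟩ := H₁
  obtain ⟨H₂d, H₂m, H₂e⟩ := H₂
  refine ⟨?_, fun j => ?_, ?_⟩
  · exact tendstoUniformlyOn_of_equicontinuousOn isCompact_Icc H₂d H₁d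
  · exact tendstoUniformlyOn_of_equicontinuousOn isCompact_Icc (H₂m j) (H₁m j)
  · exact tendstoUniformlyOn_of_equicontinuousOn isCompact_Icc H₂e H₁e

/-- **The skeleton concludes the crux BY NAME**: `ScoreLinearResponse` (route `OneSphereInfluence`,
stmt-AtomisticToContinuum-13617) from the two registered stubs, through the sorry-free composition
`scoreLinearResponse_of_parts` (the crux decl unfolds to its conclusion by `rfl`). -/
theorem ScoreLinearResponse_of :
    Summit.AtomisticToContinuum.HydrodynamicLimit.Theses.OneSphereInfluence.ScoreLinearResponse :=
  scoreLinearResponse_of_parts stub_pointwiseScoreResponse stub_scoreResponseEquicontinuity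

end Summit.AtomisticToContinuum.HydrodynamicLimit.Cruxes.ScoreLinearResponse.Birth
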